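import Summits.HodgeConjecture.HodgeConjecture.Theorems.K2LiuContinuedPairingHolomorphic
import Summits.HodgeConjecture.HodgeConjecture.Theorems.K2LiuPoleOrderPinned
import Summits.HodgeConjecture.HodgeConjecture.Theorems.K2LiuContinuationsAgree
import Summits.HodgeConjecture.HodgeConjecture.Theorems.K2LiuDoubledLiftSpanReduction
import Mathlib.Analysis.Complex.Convex
import Mathlib.Analysis.Calculus.Deriv.Mul
import HarnessLib

/-!
# The residue chain of the s5 payer #47 `K2LiuFirstTermThetaPairing`: from a pole of the continued doubling pairing to a non-zero pairing of
# the residue kernel (organs (D43a)–(D46) of `K2/K2Liu-p03/g3/ROAD-47`, generic in the outputs of sockets #41 ∕ #42R)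

Track B ∕ hLiu418 = stmt-HodgeConjecture-24832, line `K2_Liu_CurveThetaSigs` ∕ tier-0 `K2_Liu_CurveThetaNonOrthogonal` (stub s5 `stub_firstTermThetaPairing`),
assembly #47 (LEAD F0P6-plan 2026-09-04 03:25Z (1)); seat `hodgecm-mathlib-K2Liu-p03` (g4).  PURE ANALYSIS over ★ `K2Lit.SiegelDoubled.doublingPairing`
(`= ∫ K x · φ₁ x.1 · conj (φ₂ x.2) d(μ ⊗ μ)`, junk `0`), for ANY adelic group datum `𝒢` and finite measure `μ`:

* §1 `exists_tendsto_sub_div_prod_sub` — the scalar `(s − s₀) / ∏_{p ∈ P} (s − p)` has a limit along `𝓝[≠] s₀` for every finite `P` (it is `1/∏_{p ≠ s₀}`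
  if `s₀ ∈ P`, and tends to `0 · (…)` otherwise); this is gap (g7) of the road: the regularising factor is bounded near the top pole.
* §2 `doublingPairing_finset_sum_of_continuous` — the doubling pairing is additive-homogeneous over FINITE SUMS of continuous kernels on the compact `[G]²`
  (gap (g4); ★ `doublingPairing_add_of_continuous`, ★ `doublingPairing_const_mul` iterated).
* §3 **`doublingPairing_residue_ne_zero`** — THE CHAIN.  Data: a holomorphic, measurable, locally uniformly bounded family `F s` of kernels on `{Re s > 0}`
  (in #47: `F s = E⋆(s, ι(ιA·, ιA·))` read on `[G]²`, from socket #41), a finite `P`, the pointwise limit `(s − ½)·(F s x ∕ ∏(s−p)) → R x` along `𝓝[≠] ½`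
  (socket #42R), and s5's continuation `Zc` (holomorphic on `U ∖ {½}`, `U ∋ ½` open convex ⊇ `{Re s > s₁}`) with a GENUINE POLE `(s−½)^k Zc → ρ ≠ 0` and
  the agreement `(∏(s−p))·Zc(s) = 𝒫(F s)` on `{Re s > s₁}`.  Conclusion: `𝒫(R) ≠ 0`.  Proof = ★ #43a (`𝒫(F s)` holomorphic) → ★ #47a (identity principle
  on the convex `U ∩ {Re s > 0}` minus the finite `P ∪ {½}`, with the agreement abscissa pushed to the right of `P`) → ★ #43 (dominated convergence along
  `𝓝[≠] ½`) → ★ #46 (`k = 1`, `ρ = 𝒫(R)`).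
[cite: Liu2021, Lem. B.12 pp. 103–104] [cite: KudlaRallis1994, §1] [cite: MoeglinWaldspurger1995, IV.1.9]

No definition, no instance, no named fact, no `sorry`; axioms ⊆ {propext, Classical.choice, Quot.sound}.

## References
* [Liu2021] Y. Liu, Camb. J. Math. 9 (2021), App. B Lem. B.12 pp. 103–104 («taking residue at `s = ½` on both sides of (B.5)»).
* [KudlaRallis1994] S. Kudla, S. Rallis, Ann. of Math. 140 (1994), §1.
* [MoeglinWaldspurger1995] C. Moeglin, J.-L. Waldspurger, *Spectral Decomposition and Eisenstein Series*, CUP (1995), IV.1.9.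

HONEST LABEL: HC_CM is proved only modulo the 7 printed citations (2 remaining named inputs: hLiu418 = stmt-HodgeConjecture-24832, h413 =
stmt-HodgeConjecture-24833) until rung 0 closes; this helper moves no counter.
-/

set_option autoImplicit false

set_option linter.dupNamespace false

noncomputable section

open scoped Topology
open NumberField MeasureTheory Filter Set

namespace Summit.HodgeConjecture.HodgeConjecture.Cruxes.HLiu418.K2LiuFirstTermResidueChain

open Literature.NumberTheory.Automorphic
open Literature.NumberTheory.K2Lit.SiegelDoubled
open Summit.HodgeConjecture.HodgeConjecture.Cruxes.HLiu418.K2LiuContinuedPairingHolomorphic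
open Summit.HodgeConjecture.HodgeConjecture.Cruxes.HLiu418.K2LiuResiduePairingExchange
open Summit.HodgeConjecture.HodgeConjecture.Cruxes.HLiu418.K2LiuPoleOrderPinned
open Summit.HodgeConjecture.HodgeConjecture.Cruxes.HLiu418.K2LiuContinuationsAgree
open Summit.HodgeConjecture.HodgeConjecture.Cruxes.HLiu418.K2LiuDoubledLiftSpanReduction

/-! ## §1 The regularising scalar `(s − s₀) / ∏_{p ∈ P} (s − p)` near `s₀` -/

/-- **`(s − s₀) / ∏_{p∈P}(s − p)` has a limit as `s → s₀`, `s ≠ s₀`**, for every finite `P ⊂ ℂ`: if `s₀ ∈ P` the quotient is `1 / ∏_{p ∈ P ∖ s₀}(s − p)` off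
`s₀`, continuous at `s₀`; otherwise it is continuous at `s₀` (non-vanishing denominator). [folklore] -/
theorem exists_tendsto_sub_div_prod_sub (P : Finset ℂ) (s₀ : ℂ) :
    ∃ c : ℂ, Tendsto (fun s : ℂ => (s - s₀) / ∏ p ∈ P, (s - p)) (𝓝[≠] s₀) (𝓝 c) := by
  have hQc : ∀ Q : Finset ℂ, Continuous fun s : ℂ => ∏ p ∈ Q, (s - p) := fun Q =>
    continuous_finsetProd Q fun p _ => continuous_id.sub continuous_const
  by_cases h : s₀ ∈ P
  · have hQ0 : ∏ p ∈ P.erase s₀, (s₀ - p) ≠ 0 :=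
      Finset.prod_ne_zero_iff.2 fun p hp => sub_ne_zero.2 (Finset.ne_of_mem_erase hp).symm
    refine ⟨(∏ p ∈ P.erase s₀, (s₀ - p))⁻¹, ?_⟩
    have hlim : Tendsto (fun s : ℂ => (∏ p ∈ P.erase s₀, (s - p))⁻¹) (𝓝[≠] s₀) (𝓝 (∏ p ∈ P.erase s₀, (s₀ - p))⁻¹) :=
      (((hQc (P.erase s₀)).tendsto s₀).inv₀ hQ0).mono_left nhdsWithin_le_nhds
    refine hlim.congr' ?_
    filter_upwards [self_mem_nhdsWithin] with s hs
    rw [← Finset.mul_prod_erase P (fun p => s - p) h, div_mul_cancel_left₀ (sub_ne_zero.2 hs)]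
  · have hP0 : ∏ p ∈ P, (s₀ - p) ≠ 0 :=
      Finset.prod_ne_zero_iff.2 fun p hp => sub_ne_zero.2 (by rintro rfl; exact h hp)
    refine ⟨(s₀ - s₀) * (∏ p ∈ P, (s₀ - p))⁻¹, ?_⟩
    have hlim : Tendsto (fun s : ℂ => (s - s₀) * (∏ p ∈ P, (s - p))⁻¹) (𝓝[≠] s₀) (𝓝 ((s₀ - s₀) * (∏ p ∈ P, (s₀ - p))⁻¹)) :=
      (((continuous_id.sub continuous_const).tendsto s₀).mul (((hQc P).tendsto s₀).inv₀ hP0)).mono_left nhdsWithin_le_nhds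
    refine hlim.congr' (Eventually.of_forall fun s => ?_)
    simp only [div_eq_mul_inv]

/-! ## §2 The doubling pairing over finite sums of continuous kernels -/

/-- **`𝒫(Σ_{i∈S} c_i K_i) = Σ_{i∈S} c_i 𝒫(K_i)`** for CONTINUOUS kernels `K_i` on the compact second-countable `[G]²`, `μ` finite, `w₁, w₂ ∈ L¹(μ)`
(★ `doublingPairing_add_of_continuous` and ★ `doublingPairing_const_mul`, by induction on `S`). [cite: HarrisKudlaSweet1996, §1 proof of Lem. 1.1] -/
theorem doublingPairing_finset_sum_of_continuous {K : Type} [Field K] [NumberField K] (𝒢 : AdelicGroupData.{0} K)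
    (μ : Measure 𝒢.automorphicQuotient) [IsFiniteMeasure μ] [CompactSpace 𝒢.automorphicQuotient]
    [SecondCountableTopology 𝒢.automorphicQuotient] {ι : Type*} (S : Finset ι) (c : ι → ℂ)
    (Kf : ι → 𝒢.automorphicQuotient × 𝒢.automorphicQuotient → ℂ) (hK : ∀ i ∈ S, Continuous (Kf i))
    {w₁ w₂ : 𝒢.automorphicQuotient → ℂ} (hw₁ : Integrable w₁ μ) (hw₂ : Integrable w₂ μ) :
    doublingPairing 𝒢 μ (fun x => ∑ i ∈ S, c i * Kf i x) w₁ w₂ = ∑ i ∈ S, c i * doublingPairing 𝒢 μ (Kf i) w₁ w₂ := by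
  classical
  induction S using Finset.induction_on with
  | empty =>
    simp only [Finset.sum_empty]
    exact doublingPairing_zero 𝒢 μ w₁ w₂
  | insert a S ha ih =>
    have hKa : Continuous fun x => c a * Kf a x := continuous_const.mul (hK a (Finset.mem_insert_self a S))
    have hKS : Continuous fun x => ∑ i ∈ S, c i * Kf i x :=
      continuous_finsetSum S fun i hi => continuous_const.mul (hK i (Finset.mem_insert_of_mem hi))
    simp only [Finset.sum_insert ha]
    rw [doublingPairing_add_of_continuous 𝒢 μ hKa hKS hw₁ hw₂, doublingPairing_const_mul,
      ih fun i hi => hK i (Finset.mem_insert_of_mem hi)]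

/-- **A non-zero finite sum of pairings has a non-zero term**: if `𝒫(Σ_{i∈S} c_i K_i) ≠ 0` (continuous kernels on the compact `[G]²`, `μ` finite,
`w₁, w₂ ∈ L¹(μ)`), then `𝒫(K_i) ≠ 0` for some `i ∈ S` (§2 and Mathlib `Finset.exists_ne_zero_of_sum_ne_zero`). [cite: HarrisKudlaSweet1996, §1 proof of Lem. 1.1] -/
theorem exists_doublingPairing_ne_zero_of_finset_sum {K : Type} [Field K] [NumberField K] (𝒢 : AdelicGroupData.{0} K)
    (μ : Measure 𝒢.automorphicQuotient) [IsFiniteMeasure μ] [CompactSpace 𝒢.automorphicQuotient]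
    [SecondCountableTopology 𝒢.automorphicQuotient] {ι : Type*} (S : Finset ι) (c : ι → ℂ)
    (Kf : ι → 𝒢.automorphicQuotient × 𝒢.automorphicQuotient → ℂ) (hK : ∀ i ∈ S, Continuous (Kf i))
    {w₁ w₂ : 𝒢.automorphicQuotient → ℂ} (hw₁ : Integrable w₁ μ) (hw₂ : Integrable w₂ μ)
    (hne : doublingPairing 𝒢 μ (fun x => ∑ i ∈ S, c i * Kf i x) w₁ w₂ ≠ 0) :
    ∃ i ∈ S, doublingPairing 𝒢 μ (Kf i) w₁ w₂ ≠ 0 := by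
  rw [doublingPairing_finset_sum_of_continuous 𝒢 μ S c Kf hK hw₁ hw₂] at hne
  obtain ⟨i, hi, h⟩ := Finset.exists_ne_zero_of_sum_ne_zero hne
  exact ⟨i, hi, fun h0 => h (by rw [h0, mul_zero])⟩

/-! ## §3 The residue chain -/

/-- the real part is `1`-Lipschitz: `dist s z < z.re ⇒ 0 < s.re`. [folklore] -/
theorem re_pos_of_dist_lt_re {s z : ℂ} (h : dist s z < z.re) : 0 < s.re := by
  have h1 : |s.re - z.re| ≤ dist s z := by
    rw [dist_eq_norm, ← Complex.sub_re]
    exact Complex.abs_re_le_norm (s - z)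
  have h2 := (abs_lt.1 (lt_of_le_of_lt h1 h)).1
  linarith

/-- **THE RESIDUE CHAIN** (organs (D43a) → (D47a) → (D43) → (D46) of the s5 payer): a holomorphic, measurable, locally uniformly bounded family of kernels
`F s` on `{Re s > 0}` whose regularised values `(s − ½)·F s x / ∏_{p∈P}(s − p)` converge pointwise to `R x` along `𝓝[≠] ½`, and an abstract continuation `Zc`
(holomorphic on `U ∖ {½}`, `U ∋ ½` open convex, `U ⊇ {Re s > s₁}`, `s₁ ≥ 0`) with `(∏(s−p))·Zc(s) = 𝒫(F s)` on `{Re s > s₁}` and a genuine pole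
`(s − ½)^k Zc(s) → ρ ≠ 0` (`k ≥ 1`): then `𝒫(R) ≠ 0`.  In #47: `F s = toQuotFun₂ (E⋆(s) ∘ ι ∘ (ιA × ιA))` (socket #41), `R = toQuotFun₂ (Σ κᵢ Θ̃^□ᵢ ∘ ι ∘ (ιA × ιA))`
(socket #42R), `φ₁ = w`, `φ₂ = χ_{½}(ι(a_·,a_·))·w′`.  Steps: ★ #43a `continuedPairingHolomorphic` (on the disc `dist s z < min r (Re z)` the bound holds and
`Re s > 0`); `Z₂ := 𝒫(F s)/∏(s−p)` holomorphic off `P′ := P ∪ {½}`; ★ #47a `continuationsAgree` with the abscissa `max s₁ (B+1)`, `B ≥ Re p` for `p ∈ P`, so that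
the agreement half-plane avoids `P`; ★ #43 `residuePairingExchange` for `((s−½)/∏(s−p))·F s` (bound = §1 limit × the local bound at `z = ½`); `Zc = Z₂` on a
punctured neighbourhood of `½` inside `(U ∩ {Re s > 0}) ∖ P′`; ★ #46 `poleOrderPinned`.
[cite: Liu2021, Lem. B.12 pp. 103–104] [cite: KudlaRallis1994, §1] [cite: MoeglinWaldspurger1995, IV.1.9] -/
theorem doublingPairing_residue_ne_zero {K : Type} [Field K] [NumberField K] (𝒢 : AdelicGroupData.{0} K)
    (μ : Measure 𝒢.automorphicQuotient) [IsFiniteMeasure μ]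
    {φ₁ φ₂ : 𝒢.automorphicQuotient → ℂ} (hφ₁ : MemLp φ₁ 2 μ) (hφ₂ : MemLp φ₂ 2 μ)
    (P : Finset ℂ) (F : ℂ → 𝒢.automorphicQuotient × 𝒢.automorphicQuotient → ℂ)
    (R : 𝒢.automorphicQuotient × 𝒢.automorphicQuotient → ℂ)
    (hFm : ∀ s : ℂ, 0 < s.re → AEStronglyMeasurable (F s) (μ.prod μ))
    (hFd : ∀ x, DifferentiableOn ℂ (fun s => F s x) {s : ℂ | 0 < s.re})
    (hFb : ∀ z : ℂ, 0 < z.re → ∃ C r : ℝ, 0 < r ∧ ∀ s : ℂ, dist s z < r → 0 < s.re → ∀ x, ‖F s x‖ ≤ C)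
    (hlim : ∀ x, Tendsto (fun s : ℂ => (s - 1 / 2) * (F s x / ∏ p ∈ P, (s - p))) (𝓝[≠] (1 / 2)) (𝓝 (R x)))
    (U : Set ℂ) (s₁ : ℝ) (hUo : IsOpen U) (hUc : Convex ℝ U) (hU : (1 / 2 : ℂ) ∈ U) (hs₁ : (0 : ℝ) ≤ s₁)
    (hUs : {s : ℂ | s₁ < s.re} ⊆ U)
    (Zc : ℂ → ℂ) (k : ℕ) (ρ : ℂ) (hk : 1 ≤ k) (hρ : ρ ≠ 0) (hZd : DifferentiableOn ℂ Zc (U \ {(1 / 2 : ℂ)}))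
    (hZc : ∀ s : ℂ, s₁ < s.re → (∏ p ∈ P, (s - p)) * Zc s = doublingPairing 𝒢 μ (F s) φ₁ φ₂)
    (hlimZ : Tendsto (fun s : ℂ => (s - 1 / 2) ^ k * Zc s) (𝓝[≠] (1 / 2)) (𝓝 ρ)) :
    doublingPairing 𝒢 μ R φ₁ φ₂ ≠ 0 := by
  -- the continuation domain `O = {Re s > 0}` of the Eisenstein pairing
  have hOo : IsOpen {s : ℂ | 0 < s.re} := isOpen_lt continuous_const Complex.continuous_re
  have hOc : Convex ℝ {s : ℂ | 0 < s.re} := convex_halfSpace_re_gt 0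
  have hO_half : (1 / 2 : ℂ) ∈ {s : ℂ | 0 < s.re} := by
    show (0 : ℝ) < (1 / 2 : ℂ).re
    norm_num
  -- (D43a) the pairing `G s := 𝒫(F s)` is holomorphic on `O`
  have hGd : DifferentiableOn ℂ (fun s => doublingPairing 𝒢 μ (F s) φ₁ φ₂) {s : ℂ | 0 < s.re} := by
    refine continuedPairingHolomorphic K 𝒢 μ φ₁ φ₂ hφ₁ hφ₂ {s : ℂ | 0 < s.re} hOo F (fun s hs => hFm s hs) hFd ?_
    intro z hz
    obtain ⟨C, r, hr, hb⟩ := hFb z hz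
    refine ⟨C, min r z.re, lt_min hr hz, fun s hs x => hb s (lt_of_lt_of_le hs (min_le_left _ _)) ?_ x⟩
    exact re_pos_of_dist_lt_re (lt_of_lt_of_le hs (min_le_right _ _))
  -- the product `∏ (s − p)` is entire and vanishes only on `P`
  have hprod_d : Differentiable ℂ (fun s : ℂ => ∏ p ∈ P, (s - p)) :=
    Differentiable.fun_finsetProd fun p _ => differentiable_id.sub (differentiable_const p)
  have hprod_ne : ∀ s : ℂ, s ∉ (↑P : Set ℂ) → ∏ p ∈ P, (s - p) ≠ 0 := fun s hs =>
    Finset.prod_ne_zero_iff.2 fun p hp => sub_ne_zero.2 (by rintro rfl; exact hs hp)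
  -- `Z₂ := G / ∏` is holomorphic on `O ∖ P′`, `P′ := P ∪ {½}`
  have hP'f : ((↑P : Set ℂ) ∪ {(1 / 2 : ℂ)}).Finite := P.finite_toSet.union (Set.finite_singleton _)
  have hZ₂d : DifferentiableOn ℂ (fun s => doublingPairing 𝒢 μ (F s) φ₁ φ₂ / ∏ p ∈ P, (s - p))
      ({s : ℂ | 0 < s.re} \ ((↑P : Set ℂ) ∪ {(1 / 2 : ℂ)})) :=
    (hGd.mono Set.sdiff_subset).div hprod_d.differentiableOn fun s hs => hprod_ne s fun h => hs.2 (Or.inl h)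
  -- (D47a) the agreement abscissa is pushed to the right of `P`
  obtain ⟨B, hB⟩ := Finset.bddAbove (P.image Complex.re)
  have hB' : ∀ p ∈ P, p.re ≤ B := fun p hp => hB (Finset.mem_coe.2 (Finset.mem_image_of_mem Complex.re hp))
  have hs₁'U : {s : ℂ | max s₁ (B + 1) < s.re} ⊆ U := fun s hs =>
    hUs (show s₁ < s.re from lt_of_le_of_lt (le_max_left _ _) hs)
  have hs₁'O : {s : ℂ | max s₁ (B + 1) < s.re} ⊆ {s : ℂ | 0 < s.re} := fun s hs =>
    show 0 < s.re from lt_of_le_of_lt (hs₁.trans (le_max_left _ _)) hs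
  have hnotP : ∀ s : ℂ, max s₁ (B + 1) < s.re → s ∉ (↑P : Set ℂ) := fun s hs hp => by
    have h1 := hB' s (Finset.mem_coe.1 hp)
    have h2 := le_max_right s₁ (B + 1)
    linarith
  have hagree : ∀ s : ℂ, max s₁ (B + 1) < s.re → Zc s = doublingPairing 𝒢 μ (F s) φ₁ φ₂ / ∏ p ∈ P, (s - p) := fun s hs => by
    rw [eq_div_iff (hprod_ne s (hnotP s hs)), mul_comm]
    exact hZc s (lt_of_le_of_lt (le_max_left _ _) hs)
  have hEqOn : Set.EqOn Zc (fun s => doublingPairing 𝒢 μ (F s) φ₁ φ₂ / ∏ p ∈ P, (s - p))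
      ((U ∩ {s : ℂ | 0 < s.re}) \ ((↑P : Set ℂ) ∪ {(1 / 2 : ℂ)})) :=
    continuationsAgree U {s : ℂ | 0 < s.re} ((↑P : Set ℂ) ∪ {(1 / 2 : ℂ)}) hP'f hUo hUc hOo hOc (max s₁ (B + 1)) hs₁'U hs₁'O
      Zc _ (hZd.mono (Set.sdiff_subset_sdiff_right Set.subset_union_right)) hZ₂d hagree
  -- (g7) the regularising scalar has a limit at `½`
  obtain ⟨c, hc⟩ := exists_tendsto_sub_div_prod_sub P (1 / 2)
  -- (D43) dominated convergence through the pairing for `F′ s := ((s − ½)/∏(s−p)) · F s`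
  obtain ⟨C, r, hr, hb⟩ := hFb (1 / 2) hO_half
  have hdisc : ∀ᶠ s in 𝓝[≠] (1 / 2 : ℂ), dist s (1 / 2) < min r (1 / 2 : ℂ).re :=
    nhdsWithin_le_nhds (Metric.ball_mem_nhds _ (lt_min hr hO_half))
  have hre : ∀ᶠ s in 𝓝[≠] (1 / 2 : ℂ), 0 < s.re := by
    filter_upwards [hdisc] with s hs
    exact re_pos_of_dist_lt_re (lt_of_lt_of_le hs (min_le_right _ _))
  have hmeas : ∀ᶠ s in 𝓝[≠] (1 / 2 : ℂ),
      AEStronglyMeasurable (fun x => ((s - 1 / 2) / ∏ p ∈ P, (s - p)) * F s x) (μ.prod μ) := by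
    filter_upwards [hre] with s hs
    exact (hFm s hs).const_mul _
  have hbound : ∃ C' : ℝ, ∀ᶠ s in 𝓝[≠] (1 / 2 : ℂ), ∀ x, ‖((s - 1 / 2) / ∏ p ∈ P, (s - p)) * F s x‖ ≤ C' := by
    refine ⟨(‖c‖ + 1) * C, ?_⟩
    have h1 : ∀ᶠ s in 𝓝[≠] (1 / 2 : ℂ), ‖(s - 1 / 2) / ∏ p ∈ P, (s - p)‖ < ‖c‖ + 1 :=
      hc.norm.eventually (gt_mem_nhds (lt_add_one _))
    filter_upwards [h1, hdisc, hre] with s hs1 hs2 hs3 x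
    rw [norm_mul]
    exact mul_le_mul hs1.le (hb s (lt_of_lt_of_le hs2 (min_le_left _ _)) hs3 x) (norm_nonneg _) (by positivity)
  have hptw : ∀ x, Tendsto (fun s : ℂ => ((s - 1 / 2) / ∏ p ∈ P, (s - p)) * F s x) (𝓝[≠] (1 / 2)) (𝓝 (R x)) := fun x =>
    (hlim x).congr fun s => by ring
  have h43 := residuePairingExchange K 𝒢 μ φ₁ φ₂ hφ₁ hφ₂ (1 / 2) (fun s x => ((s - 1 / 2) / ∏ p ∈ P, (s - p)) * F s x) R hmeas hbound hptw
  -- transfer to `Zc` on a punctured neighbourhood of `½` inside `(U ∩ O) ∖ P′`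
  have hnhd : (U ∩ {s : ℂ | 0 < s.re}) \ (((↑P : Set ℂ) ∪ {(1 / 2 : ℂ)}) \ {(1 / 2 : ℂ)}) ∈ 𝓝 (1 / 2 : ℂ) :=
    ((hUo.inter hOo).sdiff (hP'f.subset Set.sdiff_subset).isClosed).mem_nhds ⟨⟨hU, hO_half⟩, fun h => h.2 rfl⟩
  have hev : ∀ᶠ s in 𝓝[≠] (1 / 2 : ℂ), s ∈ (U ∩ {s : ℂ | 0 < s.re}) \ ((↑P : Set ℂ) ∪ {(1 / 2 : ℂ)}) := by
    filter_upwards [mem_nhdsWithin_of_mem_nhds hnhd, self_mem_nhdsWithin] with s hs hne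
    exact ⟨hs.1, fun hP => hs.2 ⟨hP, hne⟩⟩
  have h6 : Tendsto (fun s : ℂ => (s - 1 / 2) * Zc s) (𝓝[≠] (1 / 2)) (𝓝 (doublingPairing 𝒢 μ R φ₁ φ₂)) := by
    refine h43.congr' ?_
    filter_upwards [hev] with s hs
    rw [doublingPairing_const_mul, hEqOn hs]
    ring
  -- (D46) the pole order is one and the leading coefficient is the residue pairing
  obtain ⟨-, hρℓ⟩ := poleOrderPinned Zc (1 / 2) (doublingPairing 𝒢 μ R φ₁ φ₂) ρ k hk hρ h6 hlimZ
  rw [← hρℓ]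
  exact hρ

end Summit.HodgeConjecture.HodgeConjecture.Cruxes.HLiu418.K2LiuFirstTermResidueChain

end
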